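/-
Copyright (c) 2026 the pub-hodgecm-mathlib formalisation cell (harness21).  Prover seat hodgecm-mathlib-K2Liu-p13 (g0), Track B «K2-LIT»,
#184♮ = hLiu418 = `stmt-HodgeConjecture-24832`; Road I v3 organ U1-CT-ind STAGE 2 (Q2), file F3′ (LEAD F0P6-plan (g13) 09:57:20Z «GO (Q2) F4 → F5 → D-U1 stage 3»).
-/
import Summits.HodgeConjecture.HodgeConjecture.Theorems.K2LiuDoubledAntidiagonalTransport        -- ★ F3 `exists_antidiagonal_transport` (T1)–(T4)
import Summits.HodgeConjecture.HodgeConjecture.Theorems.K2LiuSiegelMiddleStabilizerCharacter     -- ★ `siegelDeltaCharacter_eq_one_of_detDelta_eq_one`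
import HarnessLib

/-!
# Crux `HLiu418`, Road I v3, organ U1 stage 2 (Q2), file F3′: `det_Δ` OF TRANSPORTED BLOCK-TRIANGULAR ELEMENTS — `Δ`-block of `Ψ g` is `g₁₁ + X·g₂₁`,
# so block-upper-triangular `g` has `det_Δ(Ψ g) = det g₁₁` and block-unipotent `g` is killed by the Siegel character

Cell `hodgecm-mathlib`, crux item hLiu418 = `stmt-HodgeConjecture-24832`; squad K2 ∕ K2Liu; LEAD F0P6-plan (g13), co-dealer K2E5-plan (g7); prover K2Liu-p13 (g0).
THEOREMS ONLY (no `def`, no instance, no notation, no named-fact hypothesis, no `sorry`); lane `--supports stmt-HodgeConjecture-24832 --as helper` (count-neutral).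
Generic `n`; the hypotheses are the clauses (T1), (T3), (T4) of ★ F3 `K2LiuDoubledAntidiagonalTransport.exists_antidiagonal_transport` BY VALUE (consumers `obtain` the
transport `Ψ : U(J_{2n})(𝔸_{L⁺}) ≃ₜ* H(𝔸)`, `SA`, `X`, `Y`, `a` there and feed the clauses here), `φ := (algebraMap L 𝔸_L) ∘ (algebraMap L⁺ L)`.
* §1 `map_smul_one` (`(a•1).map φ = φ a • 1`) and **`deltaBlock_transport`**: `deltaBlock (Ψ g) = B₁₁ + (X.map φ)·B₂₁` where `B = reindex e₂ e₂ (adelicVal g)` — the `Δ`-block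
  of the conjugate `SA·g·SA⁻¹`, `SA = (1 X; 1 −X)`, `SA⁻¹ = (a a; Y −Y)`, `a + a = 1`, is `(g₁₁ + X g₂₁)(a + a)` (the `Y`-terms cancel between the two block columns).
* §2 BLOCK-UPPER-TRIANGULAR `g` (`adelicVal g` `BlockTriangular id`, so `B₂₁ = 0`, ★ `toBlocks₂₁_reindex_eq_zero_of_blockTriangular`): `deltaBlock (Ψ g) = B₁₁`,
  **`detDelta_transport_of_blockTriangular : det_Δ(Ψ g) = det B₁₁`**, and for BLOCK-UNIPOTENT `g` (`det B₁₁ = 1`): `siegelDeltaCharacter χ s (Ψ g) = 1`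
  (★ `siegelDeltaCharacter_eq_one_of_detDelta_eq_one`) and **`apply_transport_mul`**: every Siegel section is LEFT-`Ψ g`-INVARIANT — the letter-free half of
  «Siegel sections are left-`N_Q(𝔸)`-invariant» (F4-1; `N_Q`'s letters `n_Q(y,z,t)` of ★ F4-0 `K2LiuKlingenUnipotentDefs` are unipotent upper-triangular) and of the
  Levi bookkeeping of F5.
[HarrisKudlaSweet1996 §1 (1.11)–(1.12), (1.15)], [Kudla1994 §3 (`x(p) = det_Δ`)], [GelbartRogawski1991 §3.1], [MoeglinWaldspurger1995 II.1.7].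
HONEST LABEL.  Count-neutral helper: `HC_CM` is proved only modulo the 7 printed citations (2 remaining named inputs: hLiu418 = `stmt-HodgeConjecture-24832`,
h413 = `stmt-HodgeConjecture-24833`) until rung 0 closes.
-/

set_option autoImplicit false
set_option linter.dupNamespace false -- the mandated namespace repeats `HodgeConjecture.HodgeConjecture`

noncomputable section

open scoped Matrix
open NumberField IsDedekindDomain

namespace Summit.HodgeConjecture.HodgeConjecture.Cruxes.HLiu418.K2LiuDoubledAntidiagonalTransportLevi

open Literature.NumberTheory.Automorphic Literature.NumberTheory.Automorphic.UnitaryGroup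
open Literature.NumberTheory.GelbartRogawski1991 Literature.NumberTheory.GelbartRogawski1991.GRConstruction
open Literature.NumberTheory.GaloisRepresentations
open Literature.NumberTheory.K2Lit.SiegelDoubled
open Summit.HodgeConjecture.HodgeConjecture.Cruxes.HLiu418.K2LiuSiegelDoubledIwasawaCompact (toBlocks₂₁_reindex_eq_zero_of_blockTriangular reindex_symm_mul_mul)
open Summit.HodgeConjecture.HodgeConjecture.Cruxes.HLiu418.K2LiuSiegelMiddleStabilizerCharacter (siegelDeltaCharacter_eq_one_of_detDelta_eq_one)
open UnitaryDualPair

variable {L : Type} [Field L] [NumberField L] [IsCMField L]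
variable {N M n : ℕ} {e : Fin N × Fin M ≃ Fin n}
  {dV : Fin N → L} {hdV : ∀ i, IsCMField.complexConj L (dV i) = dV i}
  {dW : Fin M → L} {hdW : ∀ i, IsCMField.complexConj L (dW i) = dW i}

/-! ## §1 The `Δ`-block of a transported element -/

omit [IsCMField L] in
/-- `(a • 1).map φ = φ a • 1` for the scalar-extension ring map `φ : L⁺ → 𝔸_L`. [cite: HarrisKudlaSweet1996, §1 (1.11)] -/
theorem map_smul_one (a : Fp L) :
    (a • (1 : Matrix (Fin n) (Fin n) (Fp L))).map ((algebraMap L (AdeleRing (𝓞 L) L)).comp (algebraMap (Fp L) L)) =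
      ((algebraMap L (AdeleRing (𝓞 L) L)).comp (algebraMap (Fp L) L)) a • (1 : Matrix (Fin n) (Fin n) (AdeleRing (𝓞 L) L)) := by
  ext i j
  by_cases h : i = j
  · subst h; simp
  · simp [Matrix.one_apply_ne h]

/-- **THE `Δ`-BLOCK OF A TRANSPORTED ELEMENT**: under (T1) `↑(Ψ g) = SA·g·SA⁻¹` and (T3) `SA = (1 X; 1 −X)`, `SA⁻¹ = (a a; Y −Y)` (e₂-blocks), `a + a = 1`:
`deltaBlock (Ψ g) = B₁₁ + X·B₂₁`, `B = reindex e₂ e₂ (adelicVal g)` (the `Y`-columns cancel). [cite: HarrisKudlaSweet1996, §1 (1.11)–(1.12)] [cite: GelbartRogawski1991, §3.1] -/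
theorem deltaBlock_transport {SA : GL (Fin (n + n)) (AdeleRing (𝓞 L) L)}
    {Ψ : (quasiSplit (Fp L) L (IsCMField.complexConj L) (n + n)).Adelic ≃ₜ* HA L e dV hdV dW hdW} {X Y : Matrix (Fin n) (Fin n) (Fp L)} {a : Fp L}
    (hΨ : ∀ g : (quasiSplit (Fp L) L (IsCMField.complexConj L) (n + n)).Adelic,
      (((Ψ g : HA L e dV hdV dW hdW) : GL (Fin (n + n)) (AdeleRing (𝓞 L) L)) : Matrix (Fin (n + n)) (Fin (n + n)) (AdeleRing (𝓞 L) L)) =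
        (SA : Matrix (Fin (n + n)) (Fin (n + n)) (AdeleRing (𝓞 L) L)) *
          ((adelicVal (Fp L) L (IsCMField.complexConj L) (n + n) _ g : GL (Fin (n + n)) (AdeleRing (𝓞 L) L)) :
            Matrix (Fin (n + n)) (Fin (n + n)) (AdeleRing (𝓞 L) L)) *
          ((SA⁻¹ : GL (Fin (n + n)) (AdeleRing (𝓞 L) L)) : Matrix (Fin (n + n)) (Fin (n + n)) (AdeleRing (𝓞 L) L)))
    (ha : a + a = 1)
    (hSA : Matrix.reindex (e₂ (n := n)).symm (e₂ (n := n)).symm (SA : Matrix (Fin (n + n)) (Fin (n + n)) (AdeleRing (𝓞 L) L)) =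
      Matrix.fromBlocks (1 : Matrix (Fin n) (Fin n) (AdeleRing (𝓞 L) L)) (X.map ((algebraMap L (AdeleRing (𝓞 L) L)).comp (algebraMap (Fp L) L))) 1
        (-(X.map ((algebraMap L (AdeleRing (𝓞 L) L)).comp (algebraMap (Fp L) L)))))
    (hSAi : Matrix.reindex (e₂ (n := n)).symm (e₂ (n := n)).symm ((SA⁻¹ : GL (Fin (n + n)) (AdeleRing (𝓞 L) L)) : Matrix (Fin (n + n)) (Fin (n + n)) (AdeleRing (𝓞 L) L)) =
      Matrix.fromBlocks ((a • (1 : Matrix (Fin n) (Fin n) (Fp L))).map ((algebraMap L (AdeleRing (𝓞 L) L)).comp (algebraMap (Fp L) L)))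
        ((a • (1 : Matrix (Fin n) (Fin n) (Fp L))).map ((algebraMap L (AdeleRing (𝓞 L) L)).comp (algebraMap (Fp L) L)))
        (Y.map ((algebraMap L (AdeleRing (𝓞 L) L)).comp (algebraMap (Fp L) L)))
        (-(Y.map ((algebraMap L (AdeleRing (𝓞 L) L)).comp (algebraMap (Fp L) L)))))
    (g : (quasiSplit (Fp L) L (IsCMField.complexConj L) (n + n)).Adelic) :
    deltaBlock L e dV hdV dW hdW (Ψ g) =
      (Matrix.reindex (e₂ (n := n)).symm (e₂ (n := n)).symm
          ((adelicVal (Fp L) L (IsCMField.complexConj L) (n + n) _ g : GL (Fin (n + n)) (AdeleRing (𝓞 L) L)) :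
            Matrix (Fin (n + n)) (Fin (n + n)) (AdeleRing (𝓞 L) L))).toBlocks₁₁ +
        X.map ((algebraMap L (AdeleRing (𝓞 L) L)).comp (algebraMap (Fp L) L)) *
          (Matrix.reindex (e₂ (n := n)).symm (e₂ (n := n)).symm
            ((adelicVal (Fp L) L (IsCMField.complexConj L) (n + n) _ g : GL (Fin (n + n)) (AdeleRing (𝓞 L) L)) :
              Matrix (Fin (n + n)) (Fin (n + n)) (AdeleRing (𝓞 L) L))).toBlocks₂₁ := by
  dsimp only [deltaBlock, blk]
  rw [hΨ g, reindex_symm_mul_mul, hSA, hSAi, map_smul_one]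
  set B := Matrix.reindex (e₂ (n := n)).symm (e₂ (n := n)).symm
    ((adelicVal (Fp L) L (IsCMField.complexConj L) (n + n) _ g : GL (Fin (n + n)) (AdeleRing (𝓞 L) L)) :
      Matrix (Fin (n + n)) (Fin (n + n)) (AdeleRing (𝓞 L) L)) with hB
  conv_lhs => rw [← Matrix.fromBlocks_toBlocks B]
  rw [Matrix.fromBlocks_multiply, Matrix.fromBlocks_multiply, Matrix.toBlocks_fromBlocks₁₁, Matrix.toBlocks_fromBlocks₁₂]
  simp only [Matrix.one_mul, Matrix.mul_smul, Matrix.mul_one, Matrix.mul_neg]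
  rw [show ∀ (P Q : Matrix (Fin n) (Fin n) (AdeleRing (𝓞 L) L)) (c : AdeleRing (𝓞 L) L), c • P + Q + (c • P + -Q) = c • P + c • P from
      fun P Q c => by abel,
    ← add_smul, ← map_add, ha, map_one, one_smul]

/-! ## §2 Block-upper-triangular and block-unipotent elements -/

/-- **block-upper-triangular `g` has `Δ`-block `B₁₁`**. [cite: HarrisKudlaSweet1996, §1 (1.11)–(1.12)] -/
theorem deltaBlock_transport_of_blockTriangular {SA : GL (Fin (n + n)) (AdeleRing (𝓞 L) L)}
    {Ψ : (quasiSplit (Fp L) L (IsCMField.complexConj L) (n + n)).Adelic ≃ₜ* HA L e dV hdV dW hdW} {X Y : Matrix (Fin n) (Fin n) (Fp L)} {a : Fp L}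
    (hΨ : ∀ g : (quasiSplit (Fp L) L (IsCMField.complexConj L) (n + n)).Adelic,
      (((Ψ g : HA L e dV hdV dW hdW) : GL (Fin (n + n)) (AdeleRing (𝓞 L) L)) : Matrix (Fin (n + n)) (Fin (n + n)) (AdeleRing (𝓞 L) L)) =
        (SA : Matrix (Fin (n + n)) (Fin (n + n)) (AdeleRing (𝓞 L) L)) *
          ((adelicVal (Fp L) L (IsCMField.complexConj L) (n + n) _ g : GL (Fin (n + n)) (AdeleRing (𝓞 L) L)) :
            Matrix (Fin (n + n)) (Fin (n + n)) (AdeleRing (𝓞 L) L)) *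
          ((SA⁻¹ : GL (Fin (n + n)) (AdeleRing (𝓞 L) L)) : Matrix (Fin (n + n)) (Fin (n + n)) (AdeleRing (𝓞 L) L)))
    (ha : a + a = 1)
    (hSA : Matrix.reindex (e₂ (n := n)).symm (e₂ (n := n)).symm (SA : Matrix (Fin (n + n)) (Fin (n + n)) (AdeleRing (𝓞 L) L)) =
      Matrix.fromBlocks (1 : Matrix (Fin n) (Fin n) (AdeleRing (𝓞 L) L)) (X.map ((algebraMap L (AdeleRing (𝓞 L) L)).comp (algebraMap (Fp L) L))) 1
        (-(X.map ((algebraMap L (AdeleRing (𝓞 L) L)).comp (algebraMap (Fp L) L)))))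
    (hSAi : Matrix.reindex (e₂ (n := n)).symm (e₂ (n := n)).symm ((SA⁻¹ : GL (Fin (n + n)) (AdeleRing (𝓞 L) L)) : Matrix (Fin (n + n)) (Fin (n + n)) (AdeleRing (𝓞 L) L)) =
      Matrix.fromBlocks ((a • (1 : Matrix (Fin n) (Fin n) (Fp L))).map ((algebraMap L (AdeleRing (𝓞 L) L)).comp (algebraMap (Fp L) L)))
        ((a • (1 : Matrix (Fin n) (Fin n) (Fp L))).map ((algebraMap L (AdeleRing (𝓞 L) L)).comp (algebraMap (Fp L) L)))
        (Y.map ((algebraMap L (AdeleRing (𝓞 L) L)).comp (algebraMap (Fp L) L)))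
        (-(Y.map ((algebraMap L (AdeleRing (𝓞 L) L)).comp (algebraMap (Fp L) L)))))
    {g : (quasiSplit (Fp L) L (IsCMField.complexConj L) (n + n)).Adelic}
    (hB : ((adelicVal (Fp L) L (IsCMField.complexConj L) (n + n) _ g : GL (Fin (n + n)) (AdeleRing (𝓞 L) L)) :
      Matrix (Fin (n + n)) (Fin (n + n)) (AdeleRing (𝓞 L) L)).BlockTriangular id) :
    deltaBlock L e dV hdV dW hdW (Ψ g) =
      (Matrix.reindex (e₂ (n := n)).symm (e₂ (n := n)).symm
          ((adelicVal (Fp L) L (IsCMField.complexConj L) (n + n) _ g : GL (Fin (n + n)) (AdeleRing (𝓞 L) L)) :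
            Matrix (Fin (n + n)) (Fin (n + n)) (AdeleRing (𝓞 L) L))).toBlocks₁₁ := by
  rw [deltaBlock_transport hΨ ha hSA hSAi g, toBlocks₂₁_reindex_eq_zero_of_blockTriangular hB, Matrix.mul_zero, add_zero]

/-- **`det_Δ(Ψ g) = det B₁₁` for block-upper-triangular `g`** (Kudla's `x(p)` read through the transport). [cite: Kudla1994, §3] [cite: HarrisKudlaSweet1996, §1 (1.12)] -/
theorem detDelta_transport_of_blockTriangular {SA : GL (Fin (n + n)) (AdeleRing (𝓞 L) L)}
    {Ψ : (quasiSplit (Fp L) L (IsCMField.complexConj L) (n + n)).Adelic ≃ₜ* HA L e dV hdV dW hdW} {X Y : Matrix (Fin n) (Fin n) (Fp L)} {a : Fp L}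
    (hΨ : ∀ g : (quasiSplit (Fp L) L (IsCMField.complexConj L) (n + n)).Adelic,
      (((Ψ g : HA L e dV hdV dW hdW) : GL (Fin (n + n)) (AdeleRing (𝓞 L) L)) : Matrix (Fin (n + n)) (Fin (n + n)) (AdeleRing (𝓞 L) L)) =
        (SA : Matrix (Fin (n + n)) (Fin (n + n)) (AdeleRing (𝓞 L) L)) *
          ((adelicVal (Fp L) L (IsCMField.complexConj L) (n + n) _ g : GL (Fin (n + n)) (AdeleRing (𝓞 L) L)) :
            Matrix (Fin (n + n)) (Fin (n + n)) (AdeleRing (𝓞 L) L)) *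
          ((SA⁻¹ : GL (Fin (n + n)) (AdeleRing (𝓞 L) L)) : Matrix (Fin (n + n)) (Fin (n + n)) (AdeleRing (𝓞 L) L)))
    (ha : a + a = 1)
    (hSA : Matrix.reindex (e₂ (n := n)).symm (e₂ (n := n)).symm (SA : Matrix (Fin (n + n)) (Fin (n + n)) (AdeleRing (𝓞 L) L)) =
      Matrix.fromBlocks (1 : Matrix (Fin n) (Fin n) (AdeleRing (𝓞 L) L)) (X.map ((algebraMap L (AdeleRing (𝓞 L) L)).comp (algebraMap (Fp L) L))) 1
        (-(X.map ((algebraMap L (AdeleRing (𝓞 L) L)).comp (algebraMap (Fp L) L)))))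
    (hSAi : Matrix.reindex (e₂ (n := n)).symm (e₂ (n := n)).symm ((SA⁻¹ : GL (Fin (n + n)) (AdeleRing (𝓞 L) L)) : Matrix (Fin (n + n)) (Fin (n + n)) (AdeleRing (𝓞 L) L)) =
      Matrix.fromBlocks ((a • (1 : Matrix (Fin n) (Fin n) (Fp L))).map ((algebraMap L (AdeleRing (𝓞 L) L)).comp (algebraMap (Fp L) L)))
        ((a • (1 : Matrix (Fin n) (Fin n) (Fp L))).map ((algebraMap L (AdeleRing (𝓞 L) L)).comp (algebraMap (Fp L) L)))
        (Y.map ((algebraMap L (AdeleRing (𝓞 L) L)).comp (algebraMap (Fp L) L)))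
        (-(Y.map ((algebraMap L (AdeleRing (𝓞 L) L)).comp (algebraMap (Fp L) L)))))
    {g : (quasiSplit (Fp L) L (IsCMField.complexConj L) (n + n)).Adelic}
    (hB : ((adelicVal (Fp L) L (IsCMField.complexConj L) (n + n) _ g : GL (Fin (n + n)) (AdeleRing (𝓞 L) L)) :
      Matrix (Fin (n + n)) (Fin (n + n)) (AdeleRing (𝓞 L) L)).BlockTriangular id) :
    detDelta L e dV hdV dW hdW (Ψ g) =
      ((Matrix.reindex (e₂ (n := n)).symm (e₂ (n := n)).symm
          ((adelicVal (Fp L) L (IsCMField.complexConj L) (n + n) _ g : GL (Fin (n + n)) (AdeleRing (𝓞 L) L)) :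
            Matrix (Fin (n + n)) (Fin (n + n)) (AdeleRing (𝓞 L) L))).toBlocks₁₁).det := by
  dsimp only [detDelta]
  rw [deltaBlock_transport_of_blockTriangular hΨ ha hSA hSAi hB]

/-- **block-unipotent `g` (block-upper-triangular with `det B₁₁ = 1`) is killed by the Siegel character**: `χ(det_Δ(Ψ g))|det_Δ(Ψ g)|^{s+n/2} = 1`.
[cite: HarrisKudlaSweet1996, §1 (1.15)] [cite: MoeglinWaldspurger1995, II.1.7] -/
theorem siegelDeltaCharacter_transport_eq_one {SA : GL (Fin (n + n)) (AdeleRing (𝓞 L) L)}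
    {Ψ : (quasiSplit (Fp L) L (IsCMField.complexConj L) (n + n)).Adelic ≃ₜ* HA L e dV hdV dW hdW} {X Y : Matrix (Fin n) (Fin n) (Fp L)} {a : Fp L}
    (hΨ : ∀ g : (quasiSplit (Fp L) L (IsCMField.complexConj L) (n + n)).Adelic,
      (((Ψ g : HA L e dV hdV dW hdW) : GL (Fin (n + n)) (AdeleRing (𝓞 L) L)) : Matrix (Fin (n + n)) (Fin (n + n)) (AdeleRing (𝓞 L) L)) =
        (SA : Matrix (Fin (n + n)) (Fin (n + n)) (AdeleRing (𝓞 L) L)) *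
          ((adelicVal (Fp L) L (IsCMField.complexConj L) (n + n) _ g : GL (Fin (n + n)) (AdeleRing (𝓞 L) L)) :
            Matrix (Fin (n + n)) (Fin (n + n)) (AdeleRing (𝓞 L) L)) *
          ((SA⁻¹ : GL (Fin (n + n)) (AdeleRing (𝓞 L) L)) : Matrix (Fin (n + n)) (Fin (n + n)) (AdeleRing (𝓞 L) L)))
    (ha : a + a = 1)
    (hSA : Matrix.reindex (e₂ (n := n)).symm (e₂ (n := n)).symm (SA : Matrix (Fin (n + n)) (Fin (n + n)) (AdeleRing (𝓞 L) L)) =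
      Matrix.fromBlocks (1 : Matrix (Fin n) (Fin n) (AdeleRing (𝓞 L) L)) (X.map ((algebraMap L (AdeleRing (𝓞 L) L)).comp (algebraMap (Fp L) L))) 1
        (-(X.map ((algebraMap L (AdeleRing (𝓞 L) L)).comp (algebraMap (Fp L) L)))))
    (hSAi : Matrix.reindex (e₂ (n := n)).symm (e₂ (n := n)).symm ((SA⁻¹ : GL (Fin (n + n)) (AdeleRing (𝓞 L) L)) : Matrix (Fin (n + n)) (Fin (n + n)) (AdeleRing (𝓞 L) L)) =
      Matrix.fromBlocks ((a • (1 : Matrix (Fin n) (Fin n) (Fp L))).map ((algebraMap L (AdeleRing (𝓞 L) L)).comp (algebraMap (Fp L) L)))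
        ((a • (1 : Matrix (Fin n) (Fin n) (Fp L))).map ((algebraMap L (AdeleRing (𝓞 L) L)).comp (algebraMap (Fp L) L)))
        (Y.map ((algebraMap L (AdeleRing (𝓞 L) L)).comp (algebraMap (Fp L) L)))
        (-(Y.map ((algebraMap L (AdeleRing (𝓞 L) L)).comp (algebraMap (Fp L) L)))))
    {g : (quasiSplit (Fp L) L (IsCMField.complexConj L) (n + n)).Adelic}
    (hB : ((adelicVal (Fp L) L (IsCMField.complexConj L) (n + n) _ g : GL (Fin (n + n)) (AdeleRing (𝓞 L) L)) :
      Matrix (Fin (n + n)) (Fin (n + n)) (AdeleRing (𝓞 L) L)).BlockTriangular id)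
    (hdet : ((Matrix.reindex (e₂ (n := n)).symm (e₂ (n := n)).symm
          ((adelicVal (Fp L) L (IsCMField.complexConj L) (n + n) _ g : GL (Fin (n + n)) (AdeleRing (𝓞 L) L)) :
            Matrix (Fin (n + n)) (Fin (n + n)) (AdeleRing (𝓞 L) L))).toBlocks₁₁).det = 1)
    (χ : HeckeCharacter L) (s : ℂ) :
    siegelDeltaCharacter L e dV hdV dW hdW χ s (Ψ g) = 1 :=
  siegelDeltaCharacter_eq_one_of_detDelta_eq_one L e dV hdV dW hdW χ s ((detDelta_transport_of_blockTriangular hΨ ha hSA hSAi hB).trans hdet)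

/-- **SIEGEL SECTIONS ARE LEFT-INVARIANT UNDER TRANSPORTED BLOCK-UNIPOTENT ELEMENTS**: with (T4) (`Ψ` of a block-upper-triangular element lies in `P_Δ(𝔸)`),
`f (Ψ g · h) = f h` for every Siegel section `f` of `I(s, χ)`. [cite: MoeglinWaldspurger1995, II.1.7] [cite: HarrisKudlaSweet1996, §1 (1.15)] -/
theorem apply_transport_mul {SA : GL (Fin (n + n)) (AdeleRing (𝓞 L) L)}
    {Ψ : (quasiSplit (Fp L) L (IsCMField.complexConj L) (n + n)).Adelic ≃ₜ* HA L e dV hdV dW hdW} {X Y : Matrix (Fin n) (Fin n) (Fp L)} {a : Fp L}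
    (hΨ : ∀ g : (quasiSplit (Fp L) L (IsCMField.complexConj L) (n + n)).Adelic,
      (((Ψ g : HA L e dV hdV dW hdW) : GL (Fin (n + n)) (AdeleRing (𝓞 L) L)) : Matrix (Fin (n + n)) (Fin (n + n)) (AdeleRing (𝓞 L) L)) =
        (SA : Matrix (Fin (n + n)) (Fin (n + n)) (AdeleRing (𝓞 L) L)) *
          ((adelicVal (Fp L) L (IsCMField.complexConj L) (n + n) _ g : GL (Fin (n + n)) (AdeleRing (𝓞 L) L)) :
            Matrix (Fin (n + n)) (Fin (n + n)) (AdeleRing (𝓞 L) L)) *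
          ((SA⁻¹ : GL (Fin (n + n)) (AdeleRing (𝓞 L) L)) : Matrix (Fin (n + n)) (Fin (n + n)) (AdeleRing (𝓞 L) L)))
    (ha : a + a = 1)
    (hSA : Matrix.reindex (e₂ (n := n)).symm (e₂ (n := n)).symm (SA : Matrix (Fin (n + n)) (Fin (n + n)) (AdeleRing (𝓞 L) L)) =
      Matrix.fromBlocks (1 : Matrix (Fin n) (Fin n) (AdeleRing (𝓞 L) L)) (X.map ((algebraMap L (AdeleRing (𝓞 L) L)).comp (algebraMap (Fp L) L))) 1
        (-(X.map ((algebraMap L (AdeleRing (𝓞 L) L)).comp (algebraMap (Fp L) L)))))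
    (hSAi : Matrix.reindex (e₂ (n := n)).symm (e₂ (n := n)).symm ((SA⁻¹ : GL (Fin (n + n)) (AdeleRing (𝓞 L) L)) : Matrix (Fin (n + n)) (Fin (n + n)) (AdeleRing (𝓞 L) L)) =
      Matrix.fromBlocks ((a • (1 : Matrix (Fin n) (Fin n) (Fp L))).map ((algebraMap L (AdeleRing (𝓞 L) L)).comp (algebraMap (Fp L) L)))
        ((a • (1 : Matrix (Fin n) (Fin n) (Fp L))).map ((algebraMap L (AdeleRing (𝓞 L) L)).comp (algebraMap (Fp L) L)))
        (Y.map ((algebraMap L (AdeleRing (𝓞 L) L)).comp (algebraMap (Fp L) L)))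
        (-(Y.map ((algebraMap L (AdeleRing (𝓞 L) L)).comp (algebraMap (Fp L) L)))))
    (hΨP : ∀ b : (quasiSplit (Fp L) L (IsCMField.complexConj L) (n + n)).Adelic,
      ((adelicVal (Fp L) L (IsCMField.complexConj L) (n + n) _ b : GL (Fin (n + n)) (AdeleRing (𝓞 L) L)) :
          Matrix (Fin (n + n)) (Fin (n + n)) (AdeleRing (𝓞 L) L)).BlockTriangular id →
        IsSiegelDelta L e dV hdV dW hdW (Ψ b))
    {χ : HeckeCharacter L} {s : ℂ} {f : HA L e dV hdV dW hdW → ℂ} (hf : IsSiegelDeltaSection L e dV hdV dW hdW χ s f)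
    {g : (quasiSplit (Fp L) L (IsCMField.complexConj L) (n + n)).Adelic}
    (hB : ((adelicVal (Fp L) L (IsCMField.complexConj L) (n + n) _ g : GL (Fin (n + n)) (AdeleRing (𝓞 L) L)) :
      Matrix (Fin (n + n)) (Fin (n + n)) (AdeleRing (𝓞 L) L)).BlockTriangular id)
    (hdet : ((Matrix.reindex (e₂ (n := n)).symm (e₂ (n := n)).symm
          ((adelicVal (Fp L) L (IsCMField.complexConj L) (n + n) _ g : GL (Fin (n + n)) (AdeleRing (𝓞 L) L)) :
            Matrix (Fin (n + n)) (Fin (n + n)) (AdeleRing (𝓞 L) L))).toBlocks₁₁).det = 1)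
    (h : HA L e dV hdV dW hdW) :
    f (Ψ g * h) = f h := by
  rw [hf _ (hΨP g hB) h, siegelDeltaCharacter_transport_eq_one hΨ ha hSA hSAi hB hdet χ s, one_mul]

end Summit.HodgeConjecture.HodgeConjecture.Cruxes.HLiu418.K2LiuDoubledAntidiagonalTransportLevi

end
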